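import Mathlib
import Summits.NavierStokesRegularity.NavierStokesRegularity.Theorems.OrthantWakeOrthantHopWakeFlux
import HarnessLib

/-!
# `OrthantWake.OrthantHopWake` — reduction of the crux to the lever `FluxCappedByResidue`
(helper file for item stmt-NavierStokesRegularity-24639; `--supports`)

The route's two-layer plan for the crux `OrthantHopWake` (item 24639) is
`OrthantHopWake ⇐ TailFluxBudget + FluxCappedByResidue`. `TailFluxBudget` is landed
(`orthantHop_tail_le_integral_flux`: `T_{n+1}(t) ≤ ∫₀ᵗ Π_n`). This file records the composition,
kernel-checked: the statement `FluxCappedByResidue` — written out as the hypothesis of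
`orthantHopWake_of_fluxCappedByResidue`, with the SAME prefix of quantifiers and hypotheses as
the route decl and the conclusion
`∫₀ᵗ Π_n ≤ (1+ε₀)^{-(1+η)} T_n(u)` for some `u ≤ t` beyond the transient depth — implies the
route decl `OrthantHopWake` by one transitivity. So the crux is now LITERALLY the lever.

HONEST FRAMING: MODEL lattice ODEs (route OrthantWake, rung TL-M2Break); the lever is NOT proved
here (it is the open content of the crux); nothing bears on Navier–Stokes regularity.
-/

noncomputable section

-- the sub-problem namespace `NavierStokesRegularity.NavierStokesRegularity` is the tree's layout (D-0017)
set_option linter.dupNamespace false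

namespace Summit.NavierStokesRegularity.NavierStokesRegularity.Theorems

open Set MeasureTheory intervalIntegral
open Literature.Analysis.FluidPDE.TaoCascade

/-- **`FluxCappedByResidue ⇒ OrthantHopWake`.** If, for every spread `R ≥ 1`, there are
`η, κ₁ > 0` and `ε̄ ∈ (0,1]` such that for all `ε₀ ≤ ε̄`, `ν > 0`, orthant tables `α ∈ E₂(R)`,
data, windows and regular non-negative `ν`-viscous solutions, the ACCUMULATED BOND FLUX through
`n → n+1` beyond the transient depth is capped by the super-critical fraction of an earlier tail
energy, `∫₀ᵗ Π_n ≤ (1+ε₀)^{-(1+η)} T_n(u)` (`u ≤ t`), then the route decl `OrthantHopWake` holds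
(compose with the tail flux budget `T_{n+1}(t) ≤ ∫₀ᵗ Π_n`). [this file] -/
theorem orthantHopWake_of_fluxCappedByResidue
    (hF : ∀ R : ℝ, 1 ≤ R → ∃ η : ℝ, 0 < η ∧ ∃ κ₁ : ℝ, 0 < κ₁ ∧ ∃ εbar : ℝ, 0 < εbar ∧ εbar ≤ 1 ∧
      ∀ ε₀ : ℝ, 0 < ε₀ → ε₀ ≤ εbar → ∀ ν : ℝ, 0 < ν →
      ∀ α : Fin 4 → Fin 4 → Fin 4 → ℤ × ℤ × ℤ → ℝ, InTableClass R α →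
      (∀ (Y : Fin 4 → ℤ → ℝ → ℝ) (τ : ℝ), (∀ (j : Fin 4) (k : ℤ), 1 ≤ k → 0 ≤ Y j k τ) →
        ∀ δ : ℝ, 0 < δ → ∀ (i : Fin 4) (n : ℤ), 1 ≤ n → Y i n τ = 0 →
          0 ≤ quadTerm δ α Y i n τ) →
      ∀ (X₀ : Fin 4 → ℝ) (s : ℝ), 0 < s → ∀ X : Fin 4 → ℤ → ℝ → ℝ,
      (∀ (i : Fin 4) (k : ℤ), X i k 0 = if k = 0 then X₀ i else 0) →
      (∀ (i : Fin 4) (k : ℤ), k < 0 → ∀ t : ℝ, X i k t = 0) →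
      (∃ M : ℝ, ∀ (t : ℝ) (i : Fin 4) (k : ℤ), (1 + (1 + ε₀) ^ ((10 : ℝ) * k)) * |X i k t| ≤ M) →
      (∀ (i : Fin 4) (k : ℤ), Continuous (X i k)) →
      (∀ (i : Fin 4) (k : ℤ), ∀ t ∈ Icc (0 : ℝ) s, HasDerivWithinAt (X i k)
        (quadTerm ε₀ α X i k t - ν * (1 + ε₀) ^ ((2 : ℝ) * k) * X i k t) (Icc (0 : ℝ) s) t) →
      (∀ t ∈ Icc (0 : ℝ) s, ∀ (i : Fin 4) (k : ℤ), 1 ≤ k → 0 ≤ X i k t) →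
      ∀ n : ℕ, κ₁ ≤ ε₀ * n → ∀ t ∈ Icc (0 : ℝ) s, ∃ u ∈ Icc (0 : ℝ) t,
        (∫ v in (0 : ℝ)..t, botSum ε₀ α X n v) ≤
          (1 + ε₀) ^ (-(1 + η)) *
            (∑' j : ℕ, ∑ i : Fin 4, (1 / 2 : ℝ) * X i ((n : ℕ) + (j : ℤ)) u ^ 2)) :
    Summit.NavierStokesRegularity.NavierStokesRegularity.Theses.OrthantWake.OrthantHopWake := by
  unfold Summit.NavierStokesRegularity.NavierStokesRegularity.Theses.OrthantWake.OrthantHopWake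
  intro R hR
  obtain ⟨η, hη, κ₁, hκ₁, εb, hεb, hεb1, H⟩ := hF R hR
  refine ⟨η, hη, κ₁, hκ₁, εb, hεb, hεb1, ?_⟩
  intro ε₀ hε₀ hle ν hν α hα hK X₀ s hs X hinit hlow hbd hcont hder hnonneg n hn t ht
  obtain ⟨u, hu, hcap⟩ := H ε₀ hε₀ hle ν hν α hα hK X₀ s hs X hinit hlow hbd hcont hder hnonneg
    n hn t ht
  obtain ⟨M, hM⟩ := hbd
  have hbudget := orthantHop_tail_le_integral_flux hε₀ hν hα.2.1 hinit hM hcont hder n ht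
  exact ⟨u, hu, hbudget.trans hcap⟩

end Summit.NavierStokesRegularity.NavierStokesRegularity.Theorems

end
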